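import Literature.NumberTheory.EllipticCurves.BSDHeegnerPointsSignTwistProofs
import Literature.NumberTheory.EllipticCurves.QuadraticTwistKroneckerLFunctionProofs
import Literature.NumberTheory.EllipticCurves.HeegnerHypothesisKroneckerProofs
import Literature.NumberTheory.EllipticCurves.HeegnerPointsImaginaryQuadraticProofs
import Literature.NumberTheory.EllipticCurves.ModularityVersionApProofs
import Literature.NumberTheory.QuadraticFields.JacobiCharacterPrimitiveProofs
import Literature.NumberTheory.QuadraticFields.FundamentalDiscriminant
import HarnessLib

/-!
# `ord_{s=1} L(E/K, s) ≥ 1` under the Heegner hypothesis from modularity alone, for odd `d_K`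

Third proof file of `Literature/NumberTheory/EllipticCurves/BSDHeegnerPoints.lean` for the named
fact `Literature.NumberTheory.EllipticCurves.one_le_analyticRankEK W N K` (Gross 1984, §5;
Gross–Zagier 1986, IV; Darmon 2004, §3.6: for `E/ℚ` of conductor `N` and `K` imaginary quadratic
with every `p ∣ N` split, `L(E/K, s) = L(E, s) L(E^{(d_K)}, s)` vanishes to odd order at `s = 1`).

`BSDHeegnerPointsSignTwistProofs` reduced the fact to the Modularity Theorem
(`exists_isNewformOf`) and the description of the twist `E^{(d_K)}` by a primitive quadratic
Dirichlet character `χ` mod `m`, `(m, N) = 1`, with `aₙ(E^{(d_K)}) = χ(n) aₙ(E)`, `χ(−1) χ(N) = −1`.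
Here that character is **supplied for odd `d_K`**: `χ = χ_{d_K} = (· / |d_K|)`, the Jacobi character
mod `m = |d_K|` (`Literature.NumberTheory.QuadraticFields.jacobiChar`), using

* `d_K ≡ 1 (mod 4)` squarefree (`Quadratic.isFundamentalDiscriminant_discr`), so `χ` is quadratic
  and primitive (`isPrimitive_jacobiChar`; Cox Lemma 1.14, Montgomery–Vaughan Thm. 9.13);
* `(N, d_K) = 1` and `(d_K / p) = 1` for all `p ∣ N` under the Heegner hypothesis
  (`SatisfiesHeegnerHypothesis.coprime_discr`, `satisfiesHeegnerHypothesis_iff_kronecker`), whence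
  `χ(N) = 1` (`jacobiChar_natAbs_natCast_eq_one_of_forall_prime`) and good reduction of `E` at
  every `p ∣ d_K` (`WeierstrassCurve.dvd_conductorNorm_iff`: `p ∣ N_E` iff bad reduction;
  Diamond–Shurman §8.3);
* `d_K < 0` (`IsImaginaryQuadratic.discr_neg`), so `|d_K| ≡ 3 (mod 4)` and `χ(−1) = −1`
  (`jacobiChar_neg_one_of_mod_four_eq_three`);
* `aₙ(E^{(d_K)}) = (n / |d_K|) aₙ(E)` for all `n`
  (`WeierstrassCurve.LFunction_quadraticTwist_apply_of_emod_four_eq_one`, Silverman *AEC* X,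
  Exercise 10.16, including the primes dividing `d_K`, where the twist has additive reduction).

Result: `one_le_analyticRankEK_of_exists_isNewformOf_of_odd_discr` — for `K` of odd discriminant
the named fact follows from `exists_isNewformOf` (Breuil–Conrad–Diamond–Taylor 2001, Thm. A) alone;
the parity and sign inputs of Gross 1984, §5 are theorems of the tree. (Even `d_K` requires in
addition the additivity of the twist at `2`, not treated here.) Everything is proved; no named facts
are introduced (D-0026).

## References

* [Gross1984] B. H. Gross, *Heegner points on `X₀(N)`*, in *Modular Forms* (R. A. Rankin, ed.),
  Ellis Horwood (1984), 87–105, §5.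
* [GrossZagier1986] B. H. Gross, D. B. Zagier, Invent. Math. 84 (1986), 225–320, IV (0.1)–(0.2).
* [Darmon2004] H. Darmon, *Rational points on modular elliptic curves*, CBMS 101 (2004), §3.6,
  Thm. 3.15, Thm. 3.17; §3.9, Hypothesis 3.9.
* [Cox2013] D. A. Cox, *Primes of the form x² + ny²*, 2nd ed. (2013), §1.C Lemma 1.14.
* [BCDTJAMS2001] C. Breuil, B. Conrad, F. Diamond, R. Taylor, JAMS 14 (2001), Thm. A.
-/

noncomputable section

open scoped Classical NumberTheorySymbols

open WeierstrassCurve NumberField IsDedekindDomain Rat.HeightOneSpectrum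
  Literature.NumberTheory.QuadraticFields Literature.NumberTheory.EllipticCurves.ModularForms

universe u

namespace Literature.NumberTheory.EllipticCurves

variable (W : WeierstrassCurve ℚ) (N : ℕ) (K : Type u) [Field K] [NumberField K]

/-- **The Kronecker character of `K` twists `E` into `E^{(d_K)}`, for odd `d_K`.** Let `E / ℚ` be
an elliptic curve (model `W`, conductor `N_W`) and `K` an imaginary quadratic field of odd
discriminant `d_K` in which every prime dividing `N_W` splits. Then the Jacobi character
`χ = (· / |d_K|)` mod `m = |d_K|` is a primitive quadratic Dirichlet character with `(N_W, m) = 1`,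
`aₙ(E^{(d_K)}) = χ(n) aₙ(E)` for all `n`, and `χ(−1) χ(N_W) = −1` (`χ(−1) = −1` as `d_K < 0`,
`χ(N_W) = 1` as all `p ∣ N_W` split) — the hypothesis of
`one_le_analyticRankEK_of_exists_isNewformOf_of_twistCharacter` (Gross 1984, §5: "`ε(N) = 1`,
`ε(−1) = −1`"; Gross–Zagier 1986, IV (0.1); Darmon 2004, Thm. 3.17). [cite: Gross1984, §5] -/
theorem exists_twistCharacter_of_odd_discr [W.IsElliptic] (hK : IsImaginaryQuadratic K)
    (hH : SatisfiesHeegnerHypothesis (W.conductorNorm ℤ) K) (hodd : Odd (NumberField.discr K)) :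
    ∃ (m : ℕ) (_ : NeZero m) (χ : DirichletCharacter ℂ m), (W.conductorNorm ℤ).Coprime m ∧
      χ.IsQuadratic ∧ χ.IsPrimitive ∧
      (∀ n : ℕ, ((W.quadraticTwist (NumberField.discr K : ℚ)).LFunction n : ℂ) =
        χ n * (W.LFunction n : ℂ)) ∧
      χ (-1) * χ (W.conductorNorm ℤ) = -1 := by
  have h2 : Module.finrank ℚ K = 2 := hK.1
  set D : ℤ := NumberField.discr K with hDdef
  have hD0 : D ≠ 0 := NumberField.discr_ne_zero K
  have hDneg : D < 0 := hK.discr_neg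
  haveI : NeZero D.natAbs := ⟨Int.natAbs_ne_zero.mpr hD0⟩
  -- `D ≡ 1 (mod 4)` is squarefree (odd fundamental discriminant)
  obtain ⟨hD4, hsq, -⟩ | ⟨h4, -, -⟩ := Quadratic.isFundamentalDiscriminant_discr (K := K) h2
  swap
  · exfalso
    rw [Int.odd_iff] at hodd
    omega
  have hoddN : Odd D.natAbs := Int.natAbs_odd.mpr hodd
  have hsqN : Squarefree D.natAbs := Int.squarefree_natAbs.mpr hsq
  have hq3 : D.natAbs % 4 = 3 := by omega
  -- `(N, |D|) = 1`, and good reduction at the primes dividing `D`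
  have hcop : (W.conductorNorm ℤ).Coprime D.natAbs := Literature.SatisfiesHeegnerHypothesis.coprime_discr h2 hH
  have hgood : ∀ v : HeightOneSpectrum (𝓞 ℚ), ((primesEquiv v : ℕ) : ℤ) ∣ D → W.HasGoodReductionAt v := by
    intro v hv
    by_contra hbad
    have hdvdN : (primesEquiv v : ℕ) ∣ W.conductorNorm ℤ := (W.dvd_conductorNorm_iff v).mpr hbad
    have hdvdD : (primesEquiv v : ℕ) ∣ D.natAbs := Int.natCast_dvd.mp hv
    exact (primesEquiv v).2.one_lt.ne' (Nat.Coprime.eq_one_of_dvd (Nat.Coprime.coprime_dvd_left hdvdN hcop) hdvdD)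
  have hNpos : 0 < W.conductorNorm ℤ := W.conductorNorm_pos_holds
  refine ⟨D.natAbs, inferInstance, jacobiChar D.natAbs, hcop, isQuadratic_jacobiChar,
    isPrimitive_jacobiChar hoddN hsqN, fun n ↦ ?_, ?_⟩
  · rw [jacobiChar_natCast, W.LFunction_quadraticTwist_apply_of_emod_four_eq_one hD4 hsq hgood n]
    push_cast
    rfl
  · rw [jacobiChar_neg_one_of_mod_four_eq_three hq3,
      jacobiChar_natAbs_natCast_eq_one_of_forall_prime hD4 hNpos.ne'
        ((satisfiesHeegnerHypothesis_iff_kronecker (W.conductorNorm ℤ) K h2).mp hH)]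
    norm_num

/-- **`one_le_analyticRankEK W N K` from the Modularity Theorem, for odd `d_K`** (Gross 1984, §5;
Gross–Zagier 1986, IV; Darmon 2004, §3.6). Assume `exists_isNewformOf` (every elliptic `E / ℚ` has
a newform `f ∈ S₂(Γ₀(N_E))` with `aₙ(f) = aₙ(E)`; Wiles 1995, Breuil–Conrad–Diamond–Taylor 2001,
Thm. A, with Carayol 1986). Then for `W` elliptic of conductor `N` and `K` imaginary quadratic of odd
discriminant satisfying the Heegner hypothesis for `N`, `1 ≤ ord_{s=1} L(E, s) L(E^{(d_K)}, s)`: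
the order is odd, the functional equation of `L(E/K, s)` having sign
`w(E) w(E^{(d_K)}) = −ε · χ_{d_K}(−N) ε = −1` (parity and sign proved in
`BSDHeegnerPointsSignTwistProofs` from Atkin–Lehner and Hecke, the Kronecker character supplied by
`exists_twistCharacter_of_odd_discr`). [cite: Gross1984, §5] [cite: Darmon2004, §3.6, Thm. 3.15 and Thm. 3.17] -/
theorem one_le_analyticRankEK_of_exists_isNewformOf_of_odd_discr (hmod : exists_isNewformOf)
    (hodd : Odd (NumberField.discr K)) : one_le_analyticRankEK W N K :=
  one_le_analyticRankEK_of_exists_isNewformOf_of_twistCharacter W N K hmod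
    fun hK hH ↦ exists_twistCharacter_of_odd_discr W K hK hH hodd

end Literature.NumberTheory.EllipticCurves

end
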